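import Summits.MatrixMultiplication.OmegaCensus.SmallFormats.MatMul22nRankGF7Slack6Fast1
import Summits.MatrixMultiplication.OmegaCensus.SmallFormats.MatMul22nRankGF7Slack6Fast2
import Summits.MatrixMultiplication.OmegaCensus.SmallFormats.MatMul22nRankGF7Slack6Fast3
import Summits.MatrixMultiplication.OmegaCensus.SmallFormats.MatMul22nRankGF7Slack6Fast4
import Summits.MatrixMultiplication.OmegaCensus.SmallFormats.MatMul22nRankGF7Slack6Fast5
import Summits.MatrixMultiplication.OmegaCensus.SmallFormats.MatMul22nRankGF7Slack6Fast6
import Summits.MatrixMultiplication.OmegaCensus.SmallFormats.MatMul22nRankGF7Slack6Fast7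
import Summits.MatrixMultiplication.OmegaCensus.SmallFormats.MatMul22nRankGF7Slack6SearchSplit
import HarnessLib

/-!
# ω-census family (a): the slack-6 search checker on the fast table accessors, proved equal to the landed checker

Cell `pub-omega` (unit `pub-omega-tensor-g18`), topic `Summits/MatrixMultiplication/OmegaCensus` (sub-folder `SmallFormats`).
Framing (verbatim): lottery ticket; floor = certified bounds/negative ranges. HONEST FRAMING: kernel bookkeeping only
(`pub-omega-tensor-g18/KERNEL-S6-SPLIT.md` §3). Verbatim copies of the definitions of `MatMul22nRankGF7Slack6Search` /
`MatMul22nRankGF7Slack6SearchSplit` with the primed (binary-selector) table accessors of `MatMul22nRankGF7Slack6Fast1…7`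
(`gfind6'`, `lookup6'`, `srch6'`, `efind6'`, `slotOK6'`, `laneOK6'`, `lanes6'`, `repVal6'`, `repW6'`, `state2_6'`, and the piece
checkers `searchT6pF`, `searchT6fF`, `SearchT6F`, `mainOK6F`), each PROVED EQUAL to the landed function, so that a replay file may
`decide` the fast form and conclude the landed form (`searchT6p_of_F`, `searchT6f_of_F`, `searchT6_of_F`, `lanesOK6_of_pieceF`);
and the linear bounded quantifiers `allBelow` / `anyBelow` used by all large replayed `decide`s.
Nothing here is progress on `ω`.
-/

namespace Summit.MatrixMultiplication.OmegaCensus.SmallFormats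

/-! ## Linear bounded quantifiers for kernel replay

`decide` on `∀ i : Fin n, …` builds `n` nested instance closures (`Nat.decidableBallLT`), quadratic in the kernel and fatal in memory for
`n ≳ 10⁴` (measured: `Fin 16807`, `Fin 28590` fail); `allBelow n f` is primitive recursion, linear, and is transported to `∀ k < n` by
`allBelow_sound`. -/

/-- `f (n-1) && … && f 0` by primitive recursion on `n`. -/
noncomputable def allBelow (n : ℕ) (f : ℕ → Bool) : Bool := Nat.rec true (fun k acc => f k && acc) n

/-- `f (n-1) || … || f 0` by primitive recursion on `n`. -/
noncomputable def anyBelow (n : ℕ) (f : ℕ → Bool) : Bool := Nat.rec false (fun k acc => f k || acc) n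

/-- Unfolding `allBelow` at a successor. -/
theorem allBelow_succ (n : ℕ) (f : ℕ → Bool) : allBelow (n + 1) f = (f n && allBelow n f) := rfl

/-- Unfolding `anyBelow` at a successor. -/
theorem anyBelow_succ (n : ℕ) (f : ℕ → Bool) : anyBelow (n + 1) f = (f n || anyBelow n f) := rfl

/-- **`allBelow` is sound:** every index below `n` passes. -/
theorem allBelow_sound {f : ℕ → Bool} : ∀ {n : ℕ}, allBelow n f = true → ∀ k < n, f k = true
  | 0, _, k, hk => absurd hk (Nat.not_lt_zero k)
  | n + 1, h, k, hk => by
    rw [allBelow_succ, Bool.and_eq_true] at h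
    rcases Nat.lt_succ_iff_lt_or_eq.1 hk with hk' | rfl
    · exact allBelow_sound h.2 k hk'
    · exact h.1

/-- **`anyBelow` is sound:** some index below `n` passes. -/
theorem anyBelow_sound {f : ℕ → Bool} : ∀ {n : ℕ}, anyBelow n f = true → ∃ k < n, f k = true
  | 0, h => absurd h Bool.false_ne_true
  | n + 1, h => by
    rw [anyBelow_succ, Bool.or_eq_true] at h
    rcases h with h | h
    · exact ⟨n, Nat.lt_succ_self n, h⟩
    · obtain ⟨k, hk, hfk⟩ := anyBelow_sound h
      exact ⟨k, Nat.lt_succ_of_lt hk, hfk⟩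

/-! ## Table lookups -/

/-- Fast copy of `gfind6`. -/
def gfind6' (L lo : ℕ) : ℕ → ℕ → ℕ → ℕ
  | 0, a, _ => a
  | fuel + 1, a, b => if b ≤ a then a else
      if low6' L ((a + b) / 2) < lo then gfind6' L lo fuel ((a + b) / 2 + 1) b else gfind6' L lo fuel a ((a + b) / 2)

/-- `gfind6' = gfind6`. -/
theorem gfind6'_eq : gfind6' = gfind6 := by
  funext L lo fuel
  induction fuel with
  | zero => funext a b; rfl
  | succ n ih => funext a b; rw [gfind6', gfind6, low6'_eq, ih]

/-- Fast copy of `lookup6`. -/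
def lookup6' (L K : ℕ) : Option (ℕ × ℕ) :=
  let g := K / k6LoMod L
  let lo := K % k6LoMod L
  let a := goff6' L g
  let b := goff6' L (g + 1)
  let j := gfind6' L lo 6 a b
  if j < b ∧ low6' L j = lo then
    some (gent6' L g + coff6' L j, if j + 1 < b then gent6' L g + coff6' L (j + 1) else gent6' L (g + 1))
  else none

/-- `lookup6' = lookup6`. -/
theorem lookup6'_eq : lookup6' = lookup6 := by
  funext L K; unfold lookup6' lookup6; rw [goff6'_eq, gfind6'_eq, low6'_eq, gent6'_eq, coff6'_eq]

/-- Fast copy of `repVal6`. -/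
def repVal6' (c z : ℕ) : ℕ := fld 3 (repPack6' c) z

/-- `repVal6' = repVal6`. -/
theorem repVal6'_eq : repVal6' = repVal6 := by
  funext c z; unfold repVal6' repVal6; rw [repPack6'_eq]

/-- Fast copy of `repW6`. -/
def repW6' (c : ℕ) : ℕ := ((List.range 18).map fun k => repVal6' c (fz6 0 k) * 2 ^ (12 * k)).sum

/-- `repW6' = repW6`. -/
theorem repW6'_eq : repW6' = repW6 := by
  funext c; unfold repW6' repW6; rw [repVal6'_eq]

/-- Fast copy of `state2_6`. -/
def state2_6' (c e : ℕ) : ℕ := repW6' c + expL6 e * 2 ^ 216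

/-- `state2_6' = state2_6`. -/
theorem state2_6'_eq : state2_6' = state2_6 := by
  funext c e; unfold state2_6' state2_6; rw [repW6'_eq]

/-! ## The search -/

/-- Fast copy of `srch6`. -/
def srch6' : ℕ → ℕ → ℕ → Bool
  | 0, _, _ => false
  | fuel + 1, L, W => if 21 ≤ L then false else
      if k6IsBkt L then
        match lookup6' L (needKey6 L W) with
        | none => false
        | some (s, e) => (List.range (e - s)).all fun t => srch6' fuel (L + 1) (W + expL6 (ent6' L (s + t)) * 2 ^ (12 * k6Base L))
      else (!(hepOK6 (detRes6 L W)) || srch6' fuel (L + 1) W)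

/-- `srch6' = srch6`. -/
theorem srch6'_eq : srch6' = srch6 := by
  funext fuel
  induction fuel with
  | zero => funext L W; rfl
  | succ n ih => funext L W; rw [srch6', srch6, lookup6'_eq, ent6'_eq, ih]; rfl

/-! ## CHECK B pieces -/

/-- Fast copy of `range1_6`. -/
def range1_6F (c : ℕ) : Option (ℕ × ℕ) := lookup6' 1 (needKey6 1 (repW6' c))

/-- `range1_6F = range1_6`. -/
theorem range1_6F_eq : range1_6F = range1_6 := by
  funext c; unfold range1_6F range1_6; rw [lookup6'_eq, repW6'_eq]

/-- Fast copy of `piecesOK6`. -/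
def piecesOK6F (c a b : ℕ) : Option (ℕ × ℕ) → Bool
  | none => false
  | some (s, e) => decide (b ≤ e - s) && (List.range (b - a)).all fun i => srch6' 20 2 (state2_6' c (ent6' 1 (s + (a + i))))

/-- `piecesOK6F = piecesOK6`. -/
theorem piecesOK6F_eq : piecesOK6F = piecesOK6 := by
  funext c a b r
  rcases r with _ | ⟨s, e⟩
  · rfl
  · simp only [piecesOK6F, piecesOK6, srch6'_eq, state2_6'_eq, ent6'_eq]

/-- Fast copy of `tailOK6`. -/
def tailOK6F (c a : ℕ) : Option (ℕ × ℕ) → Bool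
  | none => false
  | some (s, e) => (List.range (e - s - a)).all fun i => srch6' 20 2 (state2_6' c (ent6' 1 (s + (a + i))))

/-- `tailOK6F = tailOK6`. -/
theorem tailOK6F_eq : tailOK6F = tailOK6 := by
  funext c a r
  rcases r with _ | ⟨s, e⟩
  · rfl
  · simp only [tailOK6F, tailOK6, srch6'_eq, state2_6'_eq, ent6'_eq]

/-- Fast copy of `fullOK6`. -/
def fullOK6F (c : ℕ) : Option (ℕ × ℕ) → Bool
  | none => false
  | some (s, e) => (List.range (e - s)).all fun t => srch6' 20 2 (state2_6' c (ent6' 1 (s + t)))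

/-- `fullOK6F = fullOK6`. -/
theorem fullOK6F_eq : fullOK6F = fullOK6 := by
  funext c r
  rcases r with _ | ⟨s, e⟩
  · rfl
  · simp only [fullOK6F, fullOK6, srch6'_eq, state2_6'_eq, ent6'_eq]

/-- Fast copy of `searchT6p`. -/
def searchT6pF (c a b : ℕ) : Bool := piecesOK6F c a b (range1_6F c)

/-- Fast copy of `searchT6f`. -/
def searchT6fF (c a : ℕ) : Bool := tailOK6F c a (range1_6F c)

/-- Fast copy of `SearchT6`. -/
def SearchT6F (c : ℕ) : Prop := fullOK6F c (range1_6F c) = true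

/-- `SearchT6F c` is decided by evaluating the fast Boolean check. -/
instance instDecidableSearchT6F (c : ℕ) : Decidable (SearchT6F c) := inferInstanceAs (Decidable (fullOK6F c (range1_6F c) = true))

/-- **A fast piece is a piece.** -/
theorem searchT6p_of_F {c a b : ℕ} (h : searchT6pF c a b = true) : searchT6p c a b = true := by
  unfold searchT6pF at h; rw [piecesOK6F_eq, range1_6F_eq] at h; exact h

/-- **A fast tail is a tail.** -/
theorem searchT6f_of_F {c a : ℕ} (h : searchT6fF c a = true) : searchT6f c a = true := by
  unfold searchT6fF at h; rw [tailOK6F_eq, range1_6F_eq] at h; exact h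

/-- **The fast full check gives `SearchT6 c`.** -/
theorem searchT6_of_F {c : ℕ} (h : SearchT6F c) : SearchT6 c := by
  unfold SearchT6F at h; rw [fullOK6F_eq, range1_6F_eq] at h; exact h

/-! ## The MAIN CHECK -/

/-- Fast copy of `efind6`. -/
def efind6' (L e : ℕ) : ℕ → ℕ → ℕ → ℕ
  | 0, a, _ => a
  | fuel + 1, a, b => if b ≤ a then a else
      if ent6' L ((a + b) / 2) < e then efind6' L e fuel ((a + b) / 2 + 1) b else efind6' L e fuel a ((a + b) / 2)

/-- `efind6' = efind6`. -/
theorem efind6'_eq : efind6' = efind6 := by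
  funext L e fuel
  induction fuel with
  | zero => funext a b; rfl
  | succ n ih => funext a b; rw [efind6', efind6, ent6'_eq, ih]

/-- Fast copy of `slotOK6`. -/
def slotOK6' (L c code : ℕ) : Bool :=
  let key := code / 2 ^ 39
  let e := code % 2 ^ 39
  (bm6' L (key % 2 ^ bmb6 L) == 0) ||
  match lookup6' L key with
  | none => true
  | some (s, en) =>
      if L = 1 ∧ isTab6 c = false then
        (List.range (nkoff6' (goff6' 1 key + 1) - nkoff6' (goff6' 1 key))).all fun i =>
          srch6' 20 2 (state2_6' (clsByNeed6' (nkoff6' (goff6' 1 key) + i)) e)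
      else decide (efind6' L e 9 s en < en) && (ent6' L (efind6' L e 9 s en) == e)

/-- `slotOK6' = slotOK6`. -/
theorem slotOK6'_eq : slotOK6' = slotOK6 := by
  funext L c code
  unfold slotOK6' slotOK6
  rw [bm6'_eq, lookup6'_eq, nkoff6'_eq, goff6'_eq, srch6'_eq, state2_6'_eq, clsByNeed6'_eq, efind6'_eq, ent6'_eq]
  rfl

/-- Fast copy of `laneOK6`. -/
def laneOK6' (c K : ℕ) : Bool := (List.range 7).all fun j => slotOK6' (bktLev6 j) c ((K >>> (82 * j)) % 2 ^ 82)

/-- `laneOK6' = laneOK6`. -/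
theorem laneOK6'_eq : laneOK6' = laneOK6 := by
  funext c K; unfold laneOK6' laneOK6; rw [slotOK6'_eq]

/-- Fast copy of `lanes6`. -/
def lanes6' : ℕ → ℕ → ℕ → ℕ → Bool
  | 0, _, _, _ => false
  | fuel + 1, c, n, K => if n = 0 then true else if n = 1 then laneOK6' c (K % 2 ^ 588) else
      lanes6' fuel c (n / 2) (K &&& (2 ^ (588 * (n / 2)) - 1)) && lanes6' fuel (c + n / 2) (n - n / 2) (K >>> (588 * (n / 2)))

/-- `lanes6' = lanes6`. -/
theorem lanes6'_eq : lanes6' = lanes6 := by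
  funext fuel
  induction fuel with
  | zero => funext c n K; rfl
  | succ m ih => funext c n K; rw [lanes6', lanes6, laneOK6'_eq, ih]

/-- **Fast MAIN CHECK piece** (same total plane; fast lane checks). -/
def mainOK6F (h c₀ n : ℕ) : Bool := lanes6' 13 c₀ n ((totPlane6 h >>> (588 * c₀)) % 2 ^ (588 * n))

/-- `mainOK6F = mainOK6p`. -/
theorem mainOK6F_eq : mainOK6F = mainOK6p := by
  funext h c n; unfold mainOK6F mainOK6p; rw [lanes6'_eq]

/-- **A fast MAIN CHECK piece certifies its lanes.** -/
theorem lanesOK6_of_pieceF {h a n : ℕ} (hp : mainOK6F h a n = true) : LanesOK6 h a (a + n) :=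
  lanesOK6_of_piece (by rw [mainOK6F_eq] at hp; exact hp)

end Summit.MatrixMultiplication.OmegaCensus.SmallFormats
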